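import Summits.AtomisticToContinuum.HydrodynamicLimit.Theses.AntiMazurCoboundaries
import Summits.AtomisticToContinuum.HydrodynamicLimit.Theses.FluxGibbsianityLdDrude
import Summits.AtomisticToContinuum.HydrodynamicLimit.Theorems.JParityClosureOddContactSymmetryGibbsInvariance
import Summits.AtomisticToContinuum.HydrodynamicLimit.Theorems.KineticFluxLdDecay.Negative.TiltBasics
import Literature.MathematicalPhysics.KineticTheory.HardSphereTwoTimePressure

/-!
# Line `meso-window-split` — crux `KineticFluxLdDecay` (stmt-AtomisticToContinuum-10967)

Skeleton (crux-plan, round 1) of the crux idea `Ideas/meso-window-split.md` (ideator 2; triage r1-1/2/3: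
pass, with the sharpenings answered below). The crux is shared by the routes `AntiMazurCoboundaries` (r4)
and `FluxGibbsianityLdDrude` (r2); the two route decls are the same term (`kineticFluxLdDecay_routes_eq`,
`rfl`), and the skeleton concludes BOTH by name.

## The line

Notation: `ℓ_N = (N+1)^{-1/3}` (`scale N`), `G_N` the flow-invariant global Gibbs law (`gibbs`),
`F = Σᵢ φ(xᵢ) g((vᵢ − u₀)/√θ)` (`fluxObs`), `I_N(h; φ, g) = ∫ exp(h⁻¹∫₀ʰ F∘Φ_s ds) dG_N` (`ldLHS`, window
LENGTH `h`), `Λ_N(h) = (N+1)⁻¹ log I_N(h)`; a KINETIC horizon `τ` means the window `h = τ ℓ_N`; the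
REFERENCE horizon of a size `M` is `τ_M = (M+1)^γ` kinetic units (`horizon γ M`), `γ > 0` small.
The crux asks `∀ δ ∃ τ ∃ N₀ ∀ N ≥ N₀ ∀ Φ : I_N(τ ℓ_N) ≤ e^{δ(N+1)}` — decay in `τ` AND uniformity in `N` at
fixed kinetic time. The line SPLITS the two:

* `WindowMonotone` (stub 1, TRUE, provable now): for any flow-invariant law and bounded `F`,
  `Λ(w) ≤ Λ(h) + (h/w)·‖F‖_∞/(N+1)` for `0 < h ≤ w` (Hölder over the `⌊w/h⌋` sub-windows + invariance,
  remainder window bounded pointwise) — decay certified at ONE horizon propagates to every longer one.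
* `MesoDecay` (stub 2, OPEN — the dynamical bet, strictly WEAKER than the crux): for all large `M` there is
  SOME horizon `τ ≤ δ (M+1)^γ` (sub-polynomial in `M`, i.e. the window `τ ℓ_M` is mesoscopic and the horizon may
  grow with `M` at any sub-power rate) with `Λ_M(τ ℓ_M) ≤ δ`. Every long-time kinetic method in print returns
  horizons growing slowly with the scaling parameter; all of them land here, none in the crux directly.
* `LightConeMeso` (stub 3, LD finite speed of influence at mesoscopic horizon and range): exponential moments
  of the number of particles whose true window trajectory over `τ_M ℓ_N` differs from its range-`(M+1)^{1/4} ℓ_N`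
  local forecast (`localClusterState`, the object of the sibling crux InfluenceLocality 13916) are `e^{o(N)}`
  under `G_N`, uniformly in `N ≥ M`, for `γ ≤ γ₀`.  PLANNER'S FINDING (paper, order-of-magnitude LD cost
  estimate; line card): this is heuristically FALSE for `γ > 1/16` with range exponent `1/4` — a fast carrier of
  speed `2R/T` corrupts a whole tube `(uT − R)·T²` of forecasts through saturated collision cascades, cost per
  corrupted forecast `≈ 2R/T⁴` — which is why the card's window `ℓ_N^{1/2}` (`γ = 1/6`) is replaced by `∃ γ₀`
  (heuristically any `γ₀ < 1/16` works).
* `LocalityTransfer` (stub 4, STATICS: `LightConeMeso → MesoLocality`): given the light cone, the window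
  pressure is a local thermodynamic quantity up to mesoscopic horizons, in the ONE-DIRECTIONAL, amplitude-
  inflated form the chessboard Hölder estimate delivers (triage r1-3):
  `Λ_N(τ_M ℓ_N; φ, g) ≤ Λ_M(τ_M ℓ_M; φ, C·g) + ε` for `M ≥ N₂(ε)` and `N ≥ N₃(M)` — big system at the
  reference horizon bounded by the small system at ITS OWN mesoscopic window (Hölder gives the convex form
  `C⁻¹Λ_M(C·g)`, which implies this one because `Λ_M ≥ 0` for centred `g` — tightness, proved by the disprover).
* Composition (PROVED, `crux_of_parts`): `κ := min(κ_Meso/C, κ_Loc)`, `δ₁ := min δ 1/(κ_Meso + 2)`,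
  `M := max(N₁, N₂)`, `τ := τ_M`; Meso gives a horizon `τ₁ ≤ δ₁ τ_M` at size `M` for `C·g`, the monotone bridge
  lifts it to `τ_M` at level `δ₁(1 + κ_Meso)`, Locality transfers it to every `N ≥ N₃` at level
  `δ₁(1+κ_Meso) + δ₁ ≤ δ`; clause (A) of the crux is the tree theorem `isProbabilityMeasure_localGibbsLaw`.
  `crux_of_stubs : WindowMonotone → MesoDecay → LightConeMeso → LocalityTransfer → (crux body)`
  (`LocalityTransfer := LightConeMeso → MesoLocality`; sorry-free) and `KineticFluxLdDecay_of :
  KineticFluxLdDecay` BY NAME from the four registered stubs (the only `sorry`s of the file are the four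
  `stub_*`; the gate's `#h21_check_skeleton` wants the by-name theorem hypothesis-free).

## Disproof used (`Cruxes/KineticFluxLdDecay/Disproof.lean`, cycle 1)

`kineticFluxLdDecay_false_without_orthogonality` (PROVED; `φ ≡ 1, g ≡ κ`): honoured — `MesoDecay` keeps the
orthogonality clause verbatim and is false without it by the same window-independent witness (`Λ_M ≡ κ` at
every horizon); `MesoLocality` holds for that witness (`κ ≤ Cκ + ε`). The Gibbs-tilt near-misses (`_false_without_orthVel`,
`_false_without_orthEnergy`, `_false_allAmplitudes`, `_false_without_phiBound`, proved in NegGibbsTilts.lean)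
are flow-invariant tilts, window-independent: they refute the corresponding weakenings of `MesoDecay` exactly
as those of the crux, so `MesoDecay` keeps `⊥ v`, `⊥ |v|²`, `∃ κ` (before `φ, g`) and `|φ| ≤ 1`. The landed
Negative module `Theorems/KineticFluxLdDecay/Negative/TiltBasics.lean` is IMPORTED here (Gaussian-integral
basics only; no stub is an instance of anything it refutes). `one_le_lintegral_exp_window` (tightness
`Λ ≥ 0` for centred `g`) is consistent with every stub (all bounds are upper bounds with `δ > 0`).
-/

noncomputable section

open MeasureTheory Set Filter
open scoped ENNReal Classical

namespace Summit.AtomisticToContinuum.HydrodynamicLimit.Cruxes.KineticFluxLdDecay.MesoWindowSplit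

open Literature.MathematicalPhysics.KineticTheory (T3 V3 hsDiameter localGibbsLaw)
open Literature.Analysis.FluidPDE (HardSphereFlow Config localClusterState)
open Summit.AtomisticToContinuum.HydrodynamicLimit.Theses.AntiMazurCoboundaries (KineticFluxLdDecay)

/-! ## Frame (reducible abbreviations; the crux decl is matched by unfolding) -/

/-- Hard-sphere flows of `N + 1` spheres of diameter `σ ℓ_N` on `𝕋³` (the crux's `Φ`). -/
abbrev Flow (σ : ℝ) (N : ℕ) : Type :=
  HardSphereFlow (Literature.Analysis.FluidPDE.Torus.geometry (Fin 3)) (hsDiameter σ N) (N + 1)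

/-- Families of isolated cluster flows (same diameter, every particle number), as in InfluenceLocality. -/
abbrev ClusterFlows (σ : ℝ) (N : ℕ) : Type :=
  (k : ℕ) → HardSphereFlow (Literature.Analysis.FluidPDE.Torus.geometry (Fin 3)) (hsDiameter σ N) k

/-- Phase space of `N + 1` spheres on `𝕋³`. -/
abbrev Phase (N : ℕ) : Type := Config (N + 1) (Fin 3) T3

/-- The flow-invariant global Gibbs law `G_N` of the crux (constant profiles `a, u₀, θ`). -/
abbrev gibbs (σ a θ : ℝ) (u₀ : V3) (N : ℕ) (Φ : Flow σ N) : Measure (Phase N) :=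
  localGibbsLaw σ (fun _ => a) (fun _ => u₀) (fun _ => θ) N Φ

/-- The microscopic length `ℓ_N = (N+1)^{-1/3}` (spelled exactly as in the crux). -/
abbrev scale (N : ℕ) : ℝ := ((N + 1 : ℕ) : ℝ) ^ (-(1 / 3 : ℝ))

/-- The reference kinetic horizon `τ_M = (M+1)^γ` of the size `M`. -/
abbrev horizon (γ : ℝ) (M : ℕ) : ℝ := ((M + 1 : ℕ) : ℝ) ^ γ

/-- The orthogonality clause of the crux: `g ⊥ span{1, v, |v|²}` in `L²(stdGaussian ℝ³)`. -/
abbrev Orthogonal (g : V3 → ℝ) : Prop :=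
  ∀ (c₀ c₂ : ℝ) (b : V3),
    ∫ v, g v * (c₀ + inner ℝ b v + c₂ * ‖v‖ ^ 2) ∂(ProbabilityTheory.stdGaussian V3) = 0

/-- The fast one-body observable `F(z) = Σᵢ φ(xᵢ) g((vᵢ − u₀)/√θ)` of the crux. -/
abbrev fluxObs (θ : ℝ) (u₀ : V3) (φ : T3 → ℝ) (g : V3 → ℝ) (N : ℕ) (z : Phase N) : ℝ :=
  ∑ i, φ (z i).1 * g ((Real.sqrt θ)⁻¹ • ((z i).2 - u₀))

/-- The LD functional `I_N(h; φ, g) = ∫ exp(h⁻¹ ∫₀ʰ F(Φ_s z) ds) dG_N` at window LENGTH `h`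
(the crux's left-hand side is `ldLHS … (τ * scale N) N Φ`). -/
abbrev ldLHS (σ a θ : ℝ) (u₀ : V3) (φ : T3 → ℝ) (g : V3 → ℝ) (h : ℝ) (N : ℕ) (Φ : Flow σ N) :
    ℝ≥0∞ :=
  ∫⁻ z, ENNReal.ofReal (Real.exp (h⁻¹ * ∫ s in (0 : ℝ)..h, fluxObs θ u₀ φ g N (Φ.flow s z)))
    ∂(gibbs σ a θ u₀ N Φ)

/-- `#bad(T, r)`: the number of particles whose true state differs from their range-`r` local forecast
(`localClusterState`, tree) at some time of the window `[0, T]` (`T`, `r` macroscopic lengths; verbatim the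
`Finset.card` of InfluenceLocality stmt-13916, with horizon and range made explicit). -/
abbrev badCount {σ : ℝ} {N : ℕ} (Φ : Flow σ N) (Ψ : ClusterFlows σ N) (T r : ℝ) (z : Phase N) : ℕ :=
  (Finset.univ.filter fun i : Fin (N + 1) =>
      ∃ t ∈ Set.Icc (0 : ℝ) T, Φ.flow t z i ≠ localClusterState Ψ r t z i).card

/-! ## Stub statements -/

/-- Statement of `stub_windowMonotone` — **window monotonicity in exponential currency** (the card's lever,
general form with remainder). For a hard-sphere flow `Φ` on `𝕋³`, a `Φ`-invariant probability law `μ`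
carried by the good set, a measurable `F` with `|F| ≤ K`, and windows `0 < h ≤ w`: if
`∫ exp(h⁻¹∫₀ʰ F∘Φ_s) dμ ≤ e^A` with `A ≥ 0` then `∫ exp(w⁻¹∫₀ʷ F∘Φ_s) dμ ≤ e^{A + (h/w) K}`.
Proof plan (size M): `w = m h + r`, `m = ⌊w/h⌋ ≥ 1`, `0 ≤ r < h`; on good orbits
`exp(w⁻¹∫₀ʷ) = Πₖ Xₖ^{h/w} · Y^{r/w}` with `Xₖ = exp(h⁻¹∫_{kh}^{(k+1)h} F∘Φ) = X₀ ∘ Φ_{kh}` (`flow_add`) and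
`Y = exp(r⁻¹∫_{mh}^{w} F∘Φ) ≤ e^K` POINTWISE; generalised Hölder with exponents `h/w` (`m` times) on the
probability space (`Σ = mh/w ≤ 1`, `ENNReal.lintegral_prod_norm_pow_le` + Jensen for the deficit) and
invariance (`MeasurePreserving.lintegral_comp`) give `I(w) ≤ I(h)^{mh/w} e^{Kr/w} ≤ e^{A + Kh/w}`
(`A, K ≥ 0`, `r < h`). Joint `(s, z)`-measurability on `ℝ × good`: `HardSphereFlow.measurable_piecewise_flow_torus`. -/
def WindowMonotone : Prop :=
  ∀ (ε : ℝ) (N : ℕ) (Φ : HardSphereFlow (Literature.Analysis.FluidPDE.Torus.geometry (Fin 3)) ε (N + 1))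
    (μ : Measure (Phase N)), IsProbabilityMeasure μ → (∀ t, MeasurePreserving (Φ.flow t) μ μ) →
    (∀ᵐ z ∂μ, z ∈ Φ.good) →
    ∀ (F : Phase N → ℝ) (K : ℝ), Measurable F → (∀ z, |F z| ≤ K) →
    ∀ (h w A : ℝ), 0 < h → h ≤ w → 0 ≤ A →
      ∫⁻ z, ENNReal.ofReal (Real.exp (h⁻¹ * ∫ s in (0 : ℝ)..h, F (Φ.flow s z))) ∂μ
          ≤ ENNReal.ofReal (Real.exp A) →
      ∫⁻ z, ENNReal.ofReal (Real.exp (w⁻¹ * ∫ s in (0 : ℝ)..w, F (Φ.flow s z))) ∂μ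
          ≤ ENNReal.ofReal (Real.exp (A + h / w * K))

/-- Statement of `stub_mesoDecay` — **LD decay on SOME mesoscopic, sub-polynomial horizon** (the card's
`MesoFluxLd`, with the horizon freed: triage r1-1 "horizons growing with N have no known source at any
prescribed rate"). Crux frame (`σ < σ₀`, `∃ κ` before `φ, g`, all four admissibility clauses of the crux kept —
each is load-bearing by the window-independent Gibbs-tilt witnesses of `Disproof.lean`), then: for every
exponent `γ > 0` and `δ > 0`, for all large `M` there is a kinetic horizon `0 < τ ≤ δ (M+1)^γ` with
`∫ exp(avg over [0, τ ℓ_M] of F∘Φ) dG_M ≤ e^{δ(M+1)}` for every flow. IMPLIED BY THE CRUX (take its `τ(δ)` and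
`M` large) and strictly weaker: the horizon may depend on `M` (any `τ(M) = M^{o(1)}`), so relaxation times
diverging with `M` and restart schemes with accumulating errors are admissible here and lethal for the crux. -/
def MesoDecay : Prop :=
  ∀ (a θ : ℝ) (u₀ : V3), 0 < a → 0 < θ → ∃ σ₀ : ℝ, 0 < σ₀ ∧ ∀ σ : ℝ, 0 < σ → σ < σ₀ →
    ∃ κ : ℝ, 0 < κ ∧ ∀ (φ : T3 → ℝ) (g : V3 → ℝ), Continuous φ → Continuous g →
      (∀ x, |φ x| ≤ 1) → (∀ v, |g v| ≤ κ) → Orthogonal g →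
      ∀ γ : ℝ, 0 < γ → ∀ δ : ℝ, 0 < δ → ∃ N₁ : ℕ, ∀ M : ℕ, N₁ ≤ M →
        ∃ τ : ℝ, 0 < τ ∧ τ ≤ δ * horizon γ M ∧
          ∀ Φ : Flow σ M,
            ldLHS σ a θ u₀ φ g (τ * scale M) M Φ ≤ ENNReal.ofReal (Real.exp (δ * (M + 1)))

/-- Statement of `stub_lightConeMeso` — **LD finite speed of influence at mesoscopic horizon and range**
(the exponential-moment form triage r1-1/2/3 showed the locality half needs; InfluenceLocality 13916 is its
fixed-horizon, `∃ R` version). For `σ < σ₀` there is `γ₀ > 0` such that for every `0 < γ ≤ γ₀`, `lam, δ > 0`,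
for all large `M` and EVERY `N ≥ M`, every flow `Φ` and cluster family `Ψ` at size `N`:
`∫ exp(lam · #bad(T = (M+1)^γ ℓ_N, r = (M+1)^{1/4} ℓ_N)) dG_N ≤ e^{δ(N+1)}` — horizon `(M+1)^γ` kinetic units,
forecast range `(M+1)^{1/4}` microscopic units `≪ (M+1)^{1/3}` = side of the reference torus, so the SAME
light cone serves the big system `N` and sub-cells of the reference system `M`. Why `γ₀` must be small
(planner's cost table, ℓ-units, density 1, `θ = 1`, `T = M^γ`, `R = M^{1/4}`): a carrier of speed `u` flies
`uT`; every sphere it deflects beyond distance `R` from its start seeds a collision cascade that saturates its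
forward cone (`σ²T → ∞` mean free times), so `#bad ≈ (uT − R)·T²` at Maxwellian cost `u²/2`; optimum `u = 2R/T`,
cost per corrupted forecast `2R/T⁴ = 2M^{1/4 − 4γ}` → ∞ iff `γ < 1/16`; relay rows (13916 Disproof item 4) cost
`≳ σ²R` per row for `≈ T³` bad (`γ < 1/12`); near-jammed blobs `3 log(R/σT)` per sphere; hot spots `R²/T²`.
Nothing with bounded cost per bad particle for `γ < 1/16`; the typical bad fraction is `e^{-2M^{2(1/4−γ)}}`-small. -/
def LightConeMeso : Prop :=
  ∀ (a θ : ℝ) (u₀ : V3), 0 < a → 0 < θ → ∃ σ₀ : ℝ, 0 < σ₀ ∧ ∀ σ : ℝ, 0 < σ → σ < σ₀ →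
    ∃ γ₀ : ℝ, 0 < γ₀ ∧ ∀ γ : ℝ, 0 < γ → γ ≤ γ₀ → ∀ (lam δ : ℝ), 0 < lam → 0 < δ →
      ∃ M₀ : ℕ, ∀ M : ℕ, M₀ ≤ M → ∀ N : ℕ, M ≤ N → ∀ (Φ : Flow σ N) (Ψ : ClusterFlows σ N),
        ∫⁻ z, ENNReal.ofReal (Real.exp (lam *
            (badCount Φ Ψ (horizon γ M * scale N) (horizon (1 / 4) M * scale N) z : ℝ)))
            ∂(gibbs σ a θ u₀ N Φ)
          ≤ ENNReal.ofReal (Real.exp (δ * (N + 1)))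

/-- **Mesoscopic locality of the window pressure** (the card's `MesoLocality`, retyped one-directionally with
amplitude inflation in CONVEX form and with the quantifier order the composition needs — triage r1-2 (1),
r1-3 Doubt 2): for `σ < σ₀` there are `γ₀ > 0`, an inflation factor `C ≥ 1` and an amplitude `κ > 0` such that
for admissible `(φ, g)`, every `0 < γ ≤ γ₀` and `ε > 0`, for all reference sizes `M ≥ N₂(ε)` and every level
`A ≥ 0`: IF the inflated observable `C·g` has `I_M(τ_M ℓ_M; φ, C g) ≤ e^{A(M+1)}` for every flow at size `M`
(`τ_M = (M+1)^γ`), THEN for all `N ≥ N₃` and every flow at size `N`, `I_N(τ_M ℓ_N; φ, g) ≤ e^{(A + ε)(N+1)}`.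
In words `Λ_N(τ_M; g) ≤ Λ_M(τ_M; Cg) + ε`: the big system at the reference kinetic horizon is bounded by the
small system at its own mesoscopic window, at an inflated amplitude (chessboard Hölder yields the convex form
`C⁻¹Λ_M(Cg) + ε`, which implies this one since `Λ_M(Cg) ≥ 0` for centred `g` — `one_le_lintegral_exp_window`,
proved by the disprover; the weaker form is registered because it is all the composition consumes). Decay-free
(constants: `κ ≤ Cκ + ε`; free gas: true), but it EXCLUDES an `N`-dependent relaxation time below the
light-cone scale — that is its content. It is the consequent of `stub_localityTransfer`, not a stub by itself. -/
def MesoLocality : Prop :=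
  ∀ (a θ : ℝ) (u₀ : V3), 0 < a → 0 < θ → ∃ σ₀ : ℝ, 0 < σ₀ ∧ ∀ σ : ℝ, 0 < σ → σ < σ₀ →
    ∃ γ₀ : ℝ, 0 < γ₀ ∧ ∃ C : ℝ, 1 ≤ C ∧ ∃ κ : ℝ, 0 < κ ∧
      ∀ (φ : T3 → ℝ) (g : V3 → ℝ), Continuous φ → Continuous g →
        (∀ x, |φ x| ≤ 1) → (∀ v, |g v| ≤ κ) → Orthogonal g →
        ∀ γ : ℝ, 0 < γ → γ ≤ γ₀ → ∀ ε : ℝ, 0 < ε → ∃ N₂ : ℕ, ∀ M : ℕ, N₂ ≤ M → ∀ A : ℝ, 0 ≤ A →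
          (∀ Φ' : Flow σ M, ldLHS σ a θ u₀ φ (fun v => C * g v) (horizon γ M * scale M) M Φ'
              ≤ ENNReal.ofReal (Real.exp (A * (M + 1)))) →
          ∃ N₃ : ℕ, ∀ N : ℕ, N₃ ≤ N → ∀ Φ : Flow σ N,
            ldLHS σ a θ u₀ φ g (horizon γ M * scale N) N Φ
              ≤ ENNReal.ofReal (Real.exp ((A + ε) * (N + 1)))

/-- Statement of `stub_localityTransfer` — **statics: the light cone makes the window pressure local**
(`LightConeMeso → MesoLocality`). Proof plan (size XL, thermodynamic formalism for window functionals, no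
decay input): fix `M`, `τ = τ_M`, three scales in ℓ-units `R = M^{1/4} ≪ L' ≪ M^{1/3}` (cells of side `L'`,
corridors of width `2R`). UPPER bound at size `N`: replace trajectories by range-`R` forecasts,
`|F_window − F^loc| ≤ 2κ·#bad`, Hölder `(p, q)` puts `q⁻¹ log E_G e^{2κq·#bad} ≤ ε(N+1)` on the bill —
`LightConeMeso` at `lam = 2κq` (size `N ≥ M`); chessboard Hölder `(1+η, (1+η)/η)` splits cell bulk from corridor
layer (layer pressure `≤` volume fraction `R/L'` × static LD of particle counts); bulk cells have disjoint
`R`-neighbourhoods, hence are conditionally independent given the corridors under the GRAND-canonical hard-core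
law (finite-range DLR Markov property), and canonical `G_N` exponential moments are `≤` grand-canonical ones
`× P(number = N+1)⁻¹ = e^{O(log N)}`; `φ` is frozen per cell (`L'ℓ_N → 0`, uniform continuity). LOWER bound at
size `M`: reverse Hölder puts the inflation on the torus side, `Λ_M((1+η)·) ≥ (1+η)Λ_cells(·) − small`, cells
filled by product/tiling tilts (DV variational principle), same light cone at size `M` for the cross terms,
equivalence of ensembles in the lower direction. Both directions compare to the same family of cell pressures
with boundary conditions confined to an `R`-layer, whence `Λ_N(g) ≤ C⁻¹Λ_M(Cg) + ε ≤ Λ_M(Cg) + ε`,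
`C = (1+η)²·p` (last step: `Λ_M(Cg) ≥ 0`, tightness for centred `g`). Tools:
Ruelle1969 Ch. 3–4 (pressure independent of boundary conditions, low-density hard core), equivalence of
ensembles (KipnisLandim1999 App. 2), `Literature.Analysis.FluidPDE.localClusterState_congr` (R-locality of
forecasts), `canonicalDensity`/`particleLaw` API, `log_integral_exp_convexComb_le` (Hölder, tree). May need the
light cone for conditional / sub-system laws: derive inside the proof by the same counting (helper lemmas). -/
def LocalityTransfer : Prop := LightConeMeso → MesoLocality

/-! ## Registered stubs -/

/-- STUB 1 (size M; TRUE, provable now — generalised Hölder `ENNReal.lintegral_prod_norm_pow_le`, Jensen on a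
probability space for exponent sum `< 1`, `HardSphereFlow.flow_add` on `good`, `MeasurePreserving.lintegral_comp`,
`intervalIntegral.sum_integral_adjacent_intervals`, `HardSphereFlow.measurable_piecewise_flow_torus`). For `G_N`
its hypotheses are discharged by `Theorems.measurePreserving_flow_localGibbsLaw_const` (PROVED) and
`ae_mem_good_localGibbsLaw` (tree), as done in `crux_of_parts`. Sources: OllaVaradhanYau1993 §3 (subadditivity
of `τΛ_τ`); KipnisLandim1999 App. 1 §7. -/
theorem stub_windowMonotone : WindowMonotone := by
  sorry

/-- STUB 2 (size XL; OPEN — the HARDEST, the dynamical bet: an `N`-uniform LD ("superexponential")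
decorrelation estimate for fast one-body observables of deterministic hard spheres at fixed small density on
SOME horizon growing with `N`; false iff a kinetic-time-quasi-stationary non-Maxwellian velocity structure of
finite entropy density exists (hidden extensive charge overlapping `g`) — then the crux is false too).
Sources: OllaVaradhanYau1993 Thm 3.10 / Lemma 3.8; BGSSCPAM2023 Thm 1.1 (arXiv:2012.03813); BodineauEtAl2024
Thm 1.2–1.3, Rem. 1.3 (arXiv:2201.04514); BGSSAnnals2023; DengHaniMa2024; Spohn1991 §2.4. -/
theorem stub_mesoDecay : MesoDecay := by
  sorry

/-- STUB 3 (size L; heuristically TRUE for `γ₀ < 1/16` by the cost table in the docstring of `LightConeMeso`,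
but OPEN in print at fixed `σ` — cf. `Cruxes/InfluenceLocality/Disproof.lean` items 1, 4: Lanford-type
exponential moments of long time-ORDERED chains of scheduled pair collisions, uniformly in `N`; here the
horizon `σ²M^γ` mean free times also grows). Sources: Alexander1975/1976, MarchioroPellegrinottiPresutti1975,
CagliotiMarchioroPulvirenti2000, DobrushinFritz1977, BGSSAnnals2023 (LD over Lanford's time), GST2013. -/
theorem stub_lightConeMeso : LightConeMeso := by
  sorry

/-- STUB 4 (size XL; provable-grade STATICS given the light cone — chessboard Hölder in both directions,
DLR Markov property of the hard-core grand-canonical law, equivalence of ensembles, boundary layers; see the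
docstring of `LocalityTransfer`). Sources: Ruelle1969 Ch. 3–4, GallavottiLanfordLebowitz1970,
PulvirentiTsagkarogiannis2012 (cluster expansion in the canonical ensemble), KipnisLandim1999 App. 2. -/
theorem stub_localityTransfer : LocalityTransfer := by
  sorry

/-! ## Composition (sorry-free) -/

/-- Measurability of the crux's one-body observable (continuity of `φ, g`; coordinates of the product
configuration space are measurable). -/
theorem measurable_fluxObs {θ : ℝ} {u₀ : V3} {φ : T3 → ℝ} {g : V3 → ℝ} (hφ : Continuous φ)
    (hg : Continuous g) (N : ℕ) : Measurable (fluxObs θ u₀ φ g N) := by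
  refine Finset.measurable_sum _ fun i _ => ?_
  have h1 : Measurable fun z : Phase N => (z i).1 := (measurable_pi_apply i).fst
  have h2 : Measurable fun z : Phase N => (z i).2 := (measurable_pi_apply i).snd
  exact (hφ.measurable.comp h1).mul
    (hg.measurable.comp ((measurable_const_smul _).comp (h2.sub_const u₀)))

/-- The crux's one-body observable is bounded by `(N+1) κ`. -/
theorem abs_fluxObs_le {θ κ : ℝ} {u₀ : V3} {φ : T3 → ℝ} {g : V3 → ℝ} (hφ1 : ∀ x, |φ x| ≤ 1)
    (hgκ : ∀ v, |g v| ≤ κ) (N : ℕ) (z : Phase N) : |fluxObs θ u₀ φ g N z| ≤ (N + 1) * κ := by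
  have hκ : 0 ≤ κ := (abs_nonneg _).trans (hgκ 0)
  calc |fluxObs θ u₀ φ g N z|
      ≤ ∑ i, |φ (z i).1 * g ((Real.sqrt θ)⁻¹ • ((z i).2 - u₀))| := Finset.abs_sum_le_sum_abs _ _
    _ ≤ ∑ _i : Fin (N + 1), κ := by
        refine Finset.sum_le_sum fun i _ => ?_
        rw [abs_mul]
        calc |φ (z i).1| * |g ((Real.sqrt θ)⁻¹ • ((z i).2 - u₀))|
            ≤ 1 * κ := mul_le_mul (hφ1 _) (hgκ _) (abs_nonneg _) zero_le_one
          _ = κ := one_mul κ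
    _ = (N + 1) * κ := by simp

/-- **Composition of the line** (proved): monotone bridge + mesoscopic decay + mesoscopic locality give the
crux body (spelled with the reducible frame abbreviations): `σ₀ := min σ_Meso σ_Loc ½` (clause (A) by the tree
theorem `isProbabilityMeasure_localGibbsLaw`), `κ := min (κ_Meso/C) κ_Loc`, `δ₁ := min δ 1/(κ_Meso + 2)`,
`M := max N₁ N₂`, `τ := (M+1)^{γ₀}`, `N₀ := N₃`; levels `δ₁ → δ₁(1+κ_Meso) → δ₁(2+κ_Meso) = min δ 1`. -/
theorem crux_of_parts (hmono : WindowMonotone) (hmeso : MesoDecay) (hloc : MesoLocality) :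
    ∀ (a θ : ℝ) (u₀ : V3), 0 < a → 0 < θ → ∃ σ₀ : ℝ, 0 < σ₀ ∧ ∀ σ : ℝ, 0 < σ → σ < σ₀ →
      (∀ (N : ℕ) (Φ : Flow σ N), IsProbabilityMeasure (gibbs σ a θ u₀ N Φ)) ∧
      ∃ κ : ℝ, 0 < κ ∧ ∀ (φ : T3 → ℝ) (g : V3 → ℝ), Continuous φ → Continuous g →
        (∀ x, |φ x| ≤ 1) → (∀ v, |g v| ≤ κ) → Orthogonal g →
        ∀ δ : ℝ, 0 < δ → ∃ τ : ℝ, 0 < τ ∧ ∃ N₀ : ℕ, ∀ N : ℕ, N₀ ≤ N → ∀ Φ : Flow σ N,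
          ldLHS σ a θ u₀ φ g (τ * scale N) N Φ ≤ ENNReal.ofReal (Real.exp (δ * (N + 1))) := by
  intro a θ u₀ ha hθ
  obtain ⟨σ₁, hσ₁, H₁⟩ := hmeso a θ u₀ ha hθ
  obtain ⟨σ₂, hσ₂, H₂⟩ := hloc a θ u₀ ha hθ
  refine ⟨min (min σ₁ σ₂) (1 / 2), lt_min (lt_min hσ₁ hσ₂) (by norm_num), fun σ hσ hσlt => ?_⟩
  have hσ₁' : σ < σ₁ := lt_of_lt_of_le hσlt ((min_le_left _ _).trans (min_le_left _ _))
  have hσ₂' : σ < σ₂ := lt_of_lt_of_le hσlt ((min_le_left _ _).trans (min_le_right _ _))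
  have hσhalf : σ ≤ 1 / 2 := (lt_of_lt_of_le hσlt (min_le_right _ _)).le
  have hP : ∀ (N : ℕ) (Φ : Flow σ N), IsProbabilityMeasure (gibbs σ a θ u₀ N Φ) := fun N Φ =>
    Literature.MathematicalPhysics.KineticTheory.isProbabilityMeasure_localGibbsLaw
      continuous_const continuous_const continuous_const (fun _ => ha) (fun _ => hθ) hσhalf N Φ
  refine ⟨hP, ?_⟩
  obtain ⟨κ₁, hκ₁, G₁⟩ := H₁ σ hσ hσ₁'
  obtain ⟨γ₀, hγ₀, C, hC, κ₂, hκ₂, G₂⟩ := H₂ σ hσ hσ₂'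
  have hCpos : 0 < C := one_pos.trans_le hC
  refine ⟨min (κ₁ / C) κ₂, lt_min (div_pos hκ₁ hCpos) hκ₂, fun φ g hφ hg hφ1 hgκ horth δ hδ => ?_⟩
  -- the inflated observable `C·g` is admissible for `MesoDecay`
  have hgC : ∀ v, |C * g v| ≤ κ₁ := fun v => by
    rw [abs_mul, abs_of_pos hCpos]
    calc C * |g v| ≤ C * (κ₁ / C) :=
          mul_le_mul_of_nonneg_left ((hgκ v).trans (min_le_left _ _)) hCpos.le
      _ = κ₁ := mul_div_cancel₀ κ₁ hCpos.ne'
  have hg₂ : ∀ v, |g v| ≤ κ₂ := fun v => (hgκ v).trans (min_le_right _ _)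
  have hgCcont : Continuous fun v => C * g v := continuous_const.mul hg
  have horthC : Orthogonal fun v => C * g v := fun c₀ c₂ b => by
    have h0 := horth c₀ c₂ b
    simp_rw [mul_assoc]
    rw [integral_const_mul, h0, mul_zero]
  -- tolerances
  set δ₁ : ℝ := min δ 1 / (κ₁ + 2) with hδ₁def
  have hk2 : 0 < κ₁ + 2 := by linarith
  have hδ₁ : 0 < δ₁ := div_pos (lt_min hδ one_pos) hk2
  have hδ₁le : δ₁ ≤ 1 := by
    rw [hδ₁def, div_le_one hk2]
    exact (min_le_right _ _).trans (by linarith)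
  -- mesoscopic decay for `C·g`, locality for `g`, both at exponent `γ₀` and tolerance `δ₁`
  obtain ⟨N₁, K₁⟩ := G₁ φ (fun v => C * g v) hφ hgCcont hφ1 hgC horthC γ₀ hγ₀ δ₁ hδ₁
  obtain ⟨N₂, K₂⟩ := G₂ φ g hφ hg hφ1 hg₂ horth γ₀ hγ₀ le_rfl δ₁ hδ₁
  set M : ℕ := max N₁ N₂ with hMdef
  obtain ⟨τ₁, hτ₁, hτ₁le, Hτ₁⟩ := K₁ M (le_max_left _ _)
  have hscale : 0 < scale M := Real.rpow_pos_of_pos (by positivity) _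
  have hhor : 0 < horizon γ₀ M := Real.rpow_pos_of_pos (by positivity) _
  -- the monotone bridge lifts the bound from Meso's horizon `τ₁` to the reference horizon `τ_M`
  have hA : ∀ Φ' : Flow σ M, ldLHS σ a θ u₀ φ (fun v => C * g v) (horizon γ₀ M * scale M) M Φ'
      ≤ ENNReal.ofReal (Real.exp ((δ₁ * (1 + κ₁)) * (M + 1))) := by
    intro Φ'
    haveI := hP M Φ'
    have hinv : ∀ t, MeasurePreserving (Φ'.flow t) (gibbs σ a θ u₀ M Φ') (gibbs σ a θ u₀ M Φ') :=
      fun t => Summit.AtomisticToContinuum.HydrodynamicLimit.Theorems.measurePreserving_flow_localGibbsLaw_const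
        σ a θ u₀ M Φ' t
    have hgood : ∀ᵐ z ∂(gibbs σ a θ u₀ M Φ'), z ∈ Φ'.good :=
      Literature.MathematicalPhysics.KineticTheory.ae_mem_good_localGibbsLaw σ _ _ _ M Φ'
    have hFm : Measurable (fluxObs θ u₀ φ (fun v => C * g v) M) := measurable_fluxObs hφ hgCcont M
    have hFb : ∀ z, |fluxObs θ u₀ φ (fun v => C * g v) M z| ≤ (M + 1) * κ₁ :=
      abs_fluxObs_le hφ1 hgC M
    have hle : τ₁ * scale M ≤ horizon γ₀ M * scale M :=
      mul_le_mul_of_nonneg_right (hτ₁le.trans (mul_le_of_le_one_left hhor.le hδ₁le)) hscale.le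
    have hApos : 0 ≤ δ₁ * (M + 1) := by positivity
    have key := hmono (hsDiameter σ M) M Φ' (gibbs σ a θ u₀ M Φ') (hP M Φ') hinv hgood
      (fluxObs θ u₀ φ (fun v => C * g v) M) ((M + 1) * κ₁) hFm hFb (τ₁ * scale M)
      (horizon γ₀ M * scale M) (δ₁ * (M + 1)) (mul_pos hτ₁ hscale) hle hApos (Hτ₁ Φ')
    refine key.trans (ENNReal.ofReal_le_ofReal (Real.exp_le_exp.2 ?_))
    have hratio : τ₁ * scale M / (horizon γ₀ M * scale M) ≤ δ₁ := by
      rw [mul_div_mul_right _ _ hscale.ne', div_le_iff₀ hhor]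
      exact hτ₁le
    have hM1 : (0 : ℝ) ≤ (M + 1) * κ₁ := by positivity
    nlinarith [mul_le_mul_of_nonneg_right hratio hM1]
  obtain ⟨N₃, K₃⟩ := K₂ M (le_max_right _ _) (δ₁ * (1 + κ₁)) (by positivity) hA
  refine ⟨horizon γ₀ M, hhor, N₃, fun N hN Φ => ?_⟩
  refine (K₃ N hN Φ).trans (ENNReal.ofReal_le_ofReal (Real.exp_le_exp.2 ?_))
  have hN1 : (0 : ℝ) ≤ (N : ℝ) + 1 := by positivity
  have h2 : δ₁ * (1 + κ₁) + δ₁ = min δ 1 := by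
    rw [hδ₁def]
    field_simp
    ring
  have h3 : δ₁ * (1 + κ₁) + δ₁ ≤ δ := by linarith [min_le_left δ 1]
  exact mul_le_mul_of_nonneg_right h3 hN1

/-- **Composition from the four stub STATEMENTS** (arrow form; sorry-free): the statics transfer turns the light
cone into mesoscopic locality, and `crux_of_parts` does the rest. Its conclusion is the crux body spelled with the
frame abbreviations (definitionally the route decl; see `KineticFluxLdDecay_of`). -/
theorem crux_of_stubs (h₁ : WindowMonotone) (h₂ : MesoDecay) (h₃ : LightConeMeso) (h₄ : LocalityTransfer) :
    ∀ (a θ : ℝ) (u₀ : V3), 0 < a → 0 < θ → ∃ σ₀ : ℝ, 0 < σ₀ ∧ ∀ σ : ℝ, 0 < σ → σ < σ₀ →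
      (∀ (N : ℕ) (Φ : Flow σ N), IsProbabilityMeasure (gibbs σ a θ u₀ N Φ)) ∧
      ∃ κ : ℝ, 0 < κ ∧ ∀ (φ : T3 → ℝ) (g : V3 → ℝ), Continuous φ → Continuous g →
        (∀ x, |φ x| ≤ 1) → (∀ v, |g v| ≤ κ) → Orthogonal g →
        ∀ δ : ℝ, 0 < δ → ∃ τ : ℝ, 0 < τ ∧ ∃ N₀ : ℕ, ∀ N : ℕ, N₀ ≤ N → ∀ Φ : Flow σ N,
          ldLHS σ a θ u₀ φ g (τ * scale N) N Φ ≤ ENNReal.ofReal (Real.exp (δ * (N + 1))) :=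
  crux_of_parts h₁ h₂ (h₄ h₃)

/-- **The skeleton concludes the crux BY NAME** (route `AntiMazurCoboundaries`, stmt-AtomisticToContinuum-10967):
`KineticFluxLdDecay` from the four registered stubs (closed only by their `sorry`s; the composition itself,
`crux_of_stubs` / `crux_of_parts`, is sorry-free). -/
theorem KineticFluxLdDecay_of : KineticFluxLdDecay :=
  crux_of_stubs stub_windowMonotone stub_mesoDecay stub_lightConeMeso stub_localityTransfer

/-- The two routes' copies of the shared crux are the same term. -/
theorem kineticFluxLdDecay_routes_eq :
    Summit.AtomisticToContinuum.HydrodynamicLimit.Theses.FluxGibbsianityLdDrude.KineticFluxLdDecay =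
      KineticFluxLdDecay :=
  rfl

/-- The skeleton also concludes the `FluxGibbsianityLdDrude` copy of the crux BY NAME (same four stubs). -/
theorem KineticFluxLdDecay_of' :
    Summit.AtomisticToContinuum.HydrodynamicLimit.Theses.FluxGibbsianityLdDrude.KineticFluxLdDecay :=
  crux_of_stubs stub_windowMonotone stub_mesoDecay stub_lightConeMeso stub_localityTransfer

/-! ## Sanity: the mesoscopic decay stub is implied by the crux (so it is not a costume of it only if
strictly weaker — which it is: its horizon may depend on `M`) -/

/-- `KineticFluxLdDecay → MesoDecay`: take the crux's `τ(δ)` and `M` so large that `τ ≤ δ (M+1)^γ`. -/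
theorem mesoDecay_of_crux (h : KineticFluxLdDecay) : MesoDecay := by
  intro a θ u₀ ha hθ
  obtain ⟨σ₀, hσ₀, H⟩ := h a θ u₀ ha hθ
  refine ⟨σ₀, hσ₀, fun σ hσ hσlt => ?_⟩
  obtain ⟨-, κ, hκ, Hκ⟩ := H σ hσ hσlt
  refine ⟨κ, hκ, fun φ g hφ hg hφ1 hgκ horth γ hγ δ hδ => ?_⟩
  obtain ⟨τ, hτ, N₀, HN⟩ := Hκ φ g hφ hg hφ1 hgκ horth δ hδ
  -- choose `N₁ ≥ N₀` with `τ ≤ δ (M+1)^γ` for all `M ≥ N₁`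
  obtain ⟨K, hK⟩ := exists_nat_ge ((τ / δ) ^ (1 / γ))
  refine ⟨max N₀ K, fun M hM => ⟨τ, hτ, ?_, fun Φ => HN M ((le_max_left _ _).trans hM) Φ⟩⟩
  have hM' : (K : ℝ) ≤ (M : ℝ) := by exact_mod_cast (le_max_right _ _).trans hM
  have hbase : (τ / δ) ^ (1 / γ) ≤ ((M + 1 : ℕ) : ℝ) := by
    push_cast
    linarith
  have hpow : τ / δ ≤ horizon γ M := by
    have h1 : ((τ / δ) ^ (1 / γ)) ^ γ ≤ (((M + 1 : ℕ) : ℝ)) ^ γ :=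
      Real.rpow_le_rpow (Real.rpow_nonneg (div_pos hτ hδ).le _) hbase hγ.le
    have h2 : ((τ / δ) ^ (1 / γ)) ^ γ = τ / δ := by
      rw [← Real.rpow_mul (div_pos hτ hδ).le, one_div, inv_mul_cancel₀ hγ.ne', Real.rpow_one]
    rw [h2] at h1
    exact h1
  rwa [div_le_iff₀' hδ] at hpow

end Summit.AtomisticToContinuum.HydrodynamicLimit.Cruxes.KineticFluxLdDecay.MesoWindowSplit

end
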